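import Mathlib
import HarnessLib
import HarnessLib.Audit
import Summits.ABC.ABC.Theses.IneffectiveSubspace
import Summits.ABC.ABC.Theorems.TowerFourSubLiouville.Negative.Framing
import Summits.ABC.ABC.Theorems.TowerFourSubLiouville.Negative.DialCalibration
import Literature.NumberTheory.EllipticCurves.Heights
import Literature.NumberTheory.EllipticCurves.HeightsProofs

/-!
# Line `isotypic-demjanenko-manin` — crux `IneffectiveSubspace.TowerFourSubLiouville` (stmt-ABC-1649) — skeleton v1

Planner `planner-cruxplan-stmt-ABC-1649-isotypic-demjanenko--0` (crux-plan, round 1, 2026-08-16).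
STATUS NOTE: the crux item was closed `moot` at 2026-08-16T03:15:51Z (route `IneffectiveSubspace` retired,
"target-unreachable"); the route file is kept, the decl `TowerFourSubLiouville` still exists, and this skeleton
concludes it BY NAME.  Everything closable here is route-independent (see the line card).

THE CRUX. `TowerFourSubLiouville`: `∃ A < 2, TowerIneq(4, A)` — beat the Liouville-trivial exponent `2` on Vojta's
level-4 tower: `c < C·Π^{A+ε}` for positive coprime `a + b = c`, `a = x₀x₁²x₂³x₃⁴`, …, `Π = ∏ xᵢyᵢzᵢ`.

NORMAL FORM (PROVED here, `towerFour_of_quarticThue`; the disprover's `bad_point_shape` is the heuristic converse).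
Write `a = u·X⁴` (`u = x₀x₁²x₂³`, `X = x₃`), `b = v·Y⁴`, `c = w·Z⁴`.  The *uniform quartic Thue bound*
`QuarticThueBound := ∃ τ K C > 0, ∀ a v w Y Z > 0, a + vY⁴ = wZ⁴, gcd(a, vY⁴) = 1 → C·Z^τ ≤ a·(vw)^K`
("the isolated summand of a coprime `a + vY⁴ = wZ⁴` is not sub-polynomially small against `Z`, polynomially in the
twist `(v,w)`") implies the crux with `A = 4/(2 + κ)`, `κ = θτ/4`, `θ = 1/(1 + 3(τ + 4K)/4)`: from `Π⁴ = abc·E`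
(`towerProd_pow_four_eq`), `E³ ≥ vw`, `c ≤ 2b`, `c ≤ vw·Z⁴` and the bound, by a log-linear interpolation that
eliminates `vw` (no case split in regimes).  Conversely crux ⟹ QT (`τ = δ'`, `K = 3/2`, tower point
`x = (a,1,1,1)`, `y = (v,1,1,Y)`, `z = (w,1,1,Z)`) and `ABC ⟹ QT(τ)` for every `τ < 2` — paper, line card — so
QT is the crux in Thue coordinates, abc-sandwiched like the crux itself (`towerFourSubLiouville_of_abc`).

THE LINE (idea `isotypic-demjanenko-manin`, TRIAGE r1: fail/pass/pass).  On the ISOTYPIC SLICE `v = 1, a = X⁴` — the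
coprime twists `X⁴ + Y⁴ = w·Z⁴` of the Fermat quartic, the only twists on which TWO independent quotient maps land in
ONE elliptic curve `E_w : y² = x³ − w·x` over `ℚ`, namely `P₁ = (wZ²/Y², wX²Z/Y³)`, `P₂ = (wZ²/X², wY²Z/X³)`, with
EXACTLY equal naive height `log(wZ²)` — the Dem'janenko–Manin lattice argument gives SIZE, polynomially in `w`:
if `rank E_w(ℚ) ≤ 1` (`RankLeOne w`: `P = nG + torsion`), then `ĥ(Pᵢ) = nᵢ²ĥ(G)` and
`max(ĥ(P₁+P₂), ĥ(P₁−P₂)) = (|n₁|+|n₂|)²ĥ(G) ≥ 4·min ĥ(Pᵢ) ≥ 4(log(wZ²) − B)`, while the chord formula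
`x(P₁ ± P₂) = ((X² ± XY + Y²)/(Z(X ± Y)))²` and `max(X,Y) ≤ w^{1/4}Z` give
`ĥ(P₁ ± P₂) ≤ 2·log(3√w·Z²) + B = 2·log(wZ²) − log w + 2 log 3 + B`; hence `log(wZ²) ≤ (5B + 2 log 3)/2`, i.e.
`Z ≤ C·w^K` with ABSOLUTE `K, C` as soon as `B = sup_{E_w(ℚ)} |ĥ − h_x| ≤ α·log w + β` UNIFORMLY in `w`
(stub D; Silverman 1990 Thm 1.1, or elementary from `x(2P) = (x²+w)²/(4x(x²−w))`).  NO Lang lower bound, NO Szpiro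
ratio, NO Petsche is needed (the card's K1 route through Hindry–Silverman is bypassed by near-orthogonality), and the
Néron–Tate toolkit it does need is PROVED in the tree (`HeightsProofs`: `parallelogram_law_holds`,
`canonicalHeight_zsmul_holds`, `canonicalHeight_of_isOfFinAddOrder_holds`, …; over `ℚ` use `convert`, cf.
`Literature.NumberTheory.EllipticCurves.canonicalHeight_nsmul_rat`).

Registered stubs (4): `stub_uniformHeightDifference` [D; provable now, M/L], `stub_isotypicRankLeOne` [M1 = D → slice
bound under `RankLeOne`; provable now, L; LOAD-BEARING], `stub_isotypicHighRank` [M2 = slice bound under `¬RankLeOne`;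
OPEN — effective Mordell for the twist family `C_w` in rank ≥ 2, no mechanism; thin], `stub_quarticThueOffSlice`
[R = QT off the slice; OPEN-HARD — it IS the crux's normal form on the complement of a thin slice; shared residual with
the merged map line `fourth-radical-binomial-thue ≈ defect-radical-subliouville`].  `sorry` occurs ONLY in these four.
Composition: `quarticThueBound_of_slices` (M1 D, M2, R ⟹ QT; real proof) and `towerFour_of_quarticThue` (QT ⟹ crux;
real proof) give `TowerFourSubLiouville_of` — kernel-checked, concludes the crux BY NAME.

Disproof.lean used (refuter-cdisprove-stmt-ABC-1649-0; landed `Negative.Framing`, `Negative.DialCalibration`, both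
imported here): `towerProd_pow_four_eq` is USED in the transfer proof; `_false_without_eq` honoured (the equation is what
puts `P₁, P₂` on `E_w` in M1 and gives `Π⁴ = abcE` in the transfer), `_false_without_pos` honoured (all variables
positive; `Π ≥ 1`); coprimality is used in M1 only to get `gcd(wZ², Y²) = 1` (exact naive height) and to shrink the
isotypic locus to `u = v = 1` — consistent with `towerIneq4NoCoprime_of_abc` (coprimality not load-bearing for truth);
tightness `towerIneq4_false_below_one`, `not_towerIneq4OneNoEps` respected (we output some `A ∈ (1,2)`-type exponent
with `ε` kept and never claim `A ≤ 1`); no stub is an instance of a landed Negative lemma (the Pell families have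
`Y = Z = 1`-type top coordinates where QT is trivial; the `2^{4k} + 2^{4k}` family is not coprime).
-/

noncomputable section

namespace Summit.ABC.ABC.Cruxes.TowerFourSubLiouville.IsotypicDemjanenkoManin

open scoped BigOperators
open Summit.ABC.ABC.Theses.IneffectiveSubspace (TowerFourSubLiouville)
open Summit.ABC.ABC.Theorems.TowerFourSubLiouville.Negative (towerProd_pow_four_eq)
open WeierstrassCurve.Affine.Point (canonicalHeight naiveHeight)

/-! ## Objects and named statements of the line -/

/-- The CM curve `E_w : y² = x³ − w·x` (`j = 1728`; quartic twist by `w` of `y² = x³ − x` = 32a2), target of BOTH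
Dem'janenko–Manin maps from `X⁴ + Y⁴ = w·Z⁴`. [Mordell, Diophantine Equations, ch. 17; Demjanenko 1966] -/
def Ew (w : ℕ) : WeierstrassCurve ℚ := ⟨0, 0, 0, -(w : ℚ), 0⟩

/-- Elementary rendering of `rank E_w(ℚ) ≤ 1`: one point generates `E_w(ℚ)` up to torsion. -/
def RankLeOne (w : ℕ) : Prop :=
  ∃ G : (Ew w).toAffine.Point, ∀ P : (Ew w).toAffine.Point, ∃ n : ℤ, IsOfFinAddOrder (P - n • G)

/-- **QT · uniform quartic Thue bound** (the crux in Thue coordinates; crux-equivalent, abc-sandwiched): the isolated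
summand `a` of a coprime `a + v·Y⁴ = w·Z⁴` satisfies `C·Z^τ ≤ a·(vw)^K` with absolute `τ, K, C > 0`. -/
def QuarticThueBound : Prop :=
  ∃ τ K C : ℝ, 0 < τ ∧ 0 < C ∧ ∀ a v w Y Z : ℕ, 0 < a → 0 < v → 0 < w → 0 < Y → 0 < Z →
    a + v * Y ^ 4 = w * Z ^ 4 → Nat.Coprime a (v * Y ^ 4) →
    C * (Z : ℝ) ^ τ ≤ (a : ℝ) * ((v * w : ℕ) : ℝ) ^ K

/-- **Stub D · `UniformHeightDifference`**: the Weil–canonical difference is `O(log w)` UNIFORMLY on the family `E_w`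
(tree normalisation `ĥ = h_x + O(1)`, no `½`). [Silverman, Math. Comp. 55 (1990), Thm 1.1; or the explicit duplication
`x(2P) = (x² + w)²/(4x(x² − w))` + Tate telescoping `exists_abs_canonicalHeight_sub_naiveHeight_le_of`] -/
def UniformHeightDifference : Prop :=
  ∃ α β : ℝ, ∀ w : ℕ, 0 < w → ∀ P : (Ew w).toAffine.Point,
    |canonicalHeight P - naiveHeight P| ≤ α * Real.log w + β

/-- **Stub M1 (conclusion) · `IsotypicRankLeOne`** — Dem'janenko–Manin made polynomial in the twist: on coprime
`X⁴ + Y⁴ = w·Z⁴` with `rank E_w(ℚ) ≤ 1`, `Z ≤ C·w^K` with ABSOLUTE `K, C`. [Demjanenko 1966; Manin 1964; Cassels 1968;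
Mordell DE ch. 17 p. 155] -/
def IsotypicRankLeOne : Prop :=
  ∃ K C : ℝ, 0 < C ∧ ∀ w X Y Z : ℕ, 0 < w → 0 < X → 0 < Y → 0 < Z → Nat.Coprime X Y →
    X ^ 4 + Y ^ 4 = w * Z ^ 4 → RankLeOne w → (Z : ℝ) ≤ C * (w : ℝ) ^ K

/-- **Stub M2 · `IsotypicHighRank`** (OPEN, thin): the same bound on the twists with `rank E_w(ℚ) ≥ 2` — effective
Mordell, polynomial in `w`, for the genus-3 family `C_w`; implied by `ABC`; no mechanism offered (two independent
nearly-orthogonal points of equal height are lattice-geometrically unobstructed). [Flynn–Wetherell 2001 (w = 17)] -/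
def IsotypicHighRank : Prop :=
  ∃ K C : ℝ, 0 < C ∧ ∀ w X Y Z : ℕ, 0 < w → 0 < X → 0 < Y → 0 < Z → Nat.Coprime X Y →
    X ^ 4 + Y ^ 4 = w * Z ^ 4 → ¬ RankLeOne w → (Z : ℝ) ≤ C * (w : ℝ) ^ K

/-- **Stub R · `QuarticThueOffSlice`** (OPEN-HARD; the residual core): QT for all inputs OFF the isotypic slice
`{v = 1, a = X⁴}` — honestly, the crux's own normal form on the complement of a thin slice. -/
def QuarticThueOffSlice : Prop :=
  ∃ τ K C : ℝ, 0 < τ ∧ 0 < C ∧ ∀ a v w Y Z : ℕ, 0 < a → 0 < v → 0 < w → 0 < Y → 0 < Z →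
    a + v * Y ^ 4 = w * Z ^ 4 → Nat.Coprime a (v * Y ^ 4) → ¬ (v = 1 ∧ ∃ X : ℕ, a = X ^ 4) →
    C * (Z : ℝ) ^ τ ≤ (a : ℝ) * ((v * w : ℕ) : ℝ) ^ K

/-! ## Registered stubs — `sorry` lives ONLY in these four theorems (statements unfolded to importable declarations:
`E_w` is written `(⟨0, 0, 0, -(w : ℚ), 0⟩ : WeierstrassCurve ℚ)`) -/

/-- Stub D, registered form (= def `UniformHeightDifference`, unfolded). -/
theorem stub_uniformHeightDifference : ∃ α β : ℝ, ∀ w : ℕ, 0 < w → ∀ P : ((⟨0, 0, 0, -(w : ℚ), 0⟩ : WeierstrassCurve ℚ)).toAffine.Point, |WeierstrassCurve.Affine.Point.canonicalHeight P - WeierstrassCurve.Affine.Point.naiveHeight P| ≤ α * Real.log w + β := by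
  sorry

/-- Stub M1, registered form (= `UniformHeightDifference → IsotypicRankLeOne`, unfolded). -/
theorem stub_isotypicRankLeOne : (∃ α β : ℝ, ∀ w : ℕ, 0 < w → ∀ P : ((⟨0, 0, 0, -(w : ℚ), 0⟩ : WeierstrassCurve ℚ)).toAffine.Point, |WeierstrassCurve.Affine.Point.canonicalHeight P - WeierstrassCurve.Affine.Point.naiveHeight P| ≤ α * Real.log w + β) → ∃ K C : ℝ, 0 < C ∧ ∀ w X Y Z : ℕ, 0 < w → 0 < X → 0 < Y → 0 < Z → Nat.Coprime X Y → X ^ 4 + Y ^ 4 = w * Z ^ 4 → (∃ G : ((⟨0, 0, 0, -(w : ℚ), 0⟩ : WeierstrassCurve ℚ)).toAffine.Point, ∀ P : ((⟨0, 0, 0, -(w : ℚ), 0⟩ : WeierstrassCurve ℚ)).toAffine.Point, ∃ n : ℤ, IsOfFinAddOrder (P - n • G)) → (Z : ℝ) ≤ C * (w : ℝ) ^ K := by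
  sorry

/-- Stub M2, registered form (= def `IsotypicHighRank`, unfolded). -/
theorem stub_isotypicHighRank : ∃ K C : ℝ, 0 < C ∧ ∀ w X Y Z : ℕ, 0 < w → 0 < X → 0 < Y → 0 < Z → Nat.Coprime X Y → X ^ 4 + Y ^ 4 = w * Z ^ 4 → ¬ (∃ G : ((⟨0, 0, 0, -(w : ℚ), 0⟩ : WeierstrassCurve ℚ)).toAffine.Point, ∀ P : ((⟨0, 0, 0, -(w : ℚ), 0⟩ : WeierstrassCurve ℚ)).toAffine.Point, ∃ n : ℤ, IsOfFinAddOrder (P - n • G)) → (Z : ℝ) ≤ C * (w : ℝ) ^ K := by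
  sorry

/-- Stub R, registered form (= def `QuarticThueOffSlice`, unfolded). -/
theorem stub_quarticThueOffSlice : ∃ τ K C : ℝ, 0 < τ ∧ 0 < C ∧ ∀ a v w Y Z : ℕ, 0 < a → 0 < v → 0 < w → 0 < Y → 0 < Z → a + v * Y ^ 4 = w * Z ^ 4 → Nat.Coprime a (v * Y ^ 4) → ¬ (v = 1 ∧ ∃ X : ℕ, a = X ^ 4) → C * (Z : ℝ) ^ τ ≤ (a : ℝ) * ((v * w : ℕ) : ℝ) ^ K := by
  sorry

/-! ### Consistency: each named statement IS its registered stub (definitional unfolding only) -/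

theorem uniformHeightDifference_holds : UniformHeightDifference := stub_uniformHeightDifference
theorem isotypicRankLeOne_holds : UniformHeightDifference → IsotypicRankLeOne := stub_isotypicRankLeOne
theorem isotypicHighRank_holds : IsotypicHighRank := stub_isotypicHighRank
theorem quarticThueOffSlice_holds : QuarticThueOffSlice := stub_quarticThueOffSlice

/-! ### Name-keyed aliases of the four statements (hypotheses of the composition) -/
namespace Registered

/-- Alias of `UniformHeightDifference` keyed by the registered stub name. -/
abbrev stub_uniformHeightDifference : Prop := UniformHeightDifference
/-- Alias of `UniformHeightDifference → IsotypicRankLeOne` keyed by the registered stub name. -/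
abbrev stub_isotypicRankLeOne : Prop := UniformHeightDifference → IsotypicRankLeOne
/-- Alias of `IsotypicHighRank` keyed by the registered stub name. -/
abbrev stub_isotypicHighRank : Prop := IsotypicHighRank
/-- Alias of `QuarticThueOffSlice` keyed by the registered stub name. -/
abbrev stub_quarticThueOffSlice : Prop := QuarticThueOffSlice

end Registered

/-! ## Proved glue I (no `sorry` below this line): the slices and the residual give QT -/

/-- **Gluing.** The isotypic slice (both rank strata) and the off-slice residual give the uniform quartic Thue bound
everywhere.  On the slice `v = 1, a = X⁴`: `gcd(X⁴, Y⁴) = 1 ⟹ gcd(X, Y) = 1`, so `Z ≤ C₀·w^{K₀}` and hence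
`Z^τ ≤ C₀^τ·w^{K₀τ} ≤ C₀^τ·a·(vw)^{max(K₃, τK₀)}` (`a = X⁴ ≥ 1`, `v = 1`, `w ≥ 1`); off the slice the residual applies. -/
theorem quarticThueBound_of_slices (h₁ : IsotypicRankLeOne) (h₂ : IsotypicHighRank)
    (h₃ : QuarticThueOffSlice) : QuarticThueBound := by
  obtain ⟨K₁, C₁, hC₁, h₁⟩ := h₁
  obtain ⟨K₂, C₂, hC₂, h₂⟩ := h₂
  obtain ⟨τ, K₃, C₃, hτ, hC₃, h₃⟩ := h₃
  -- rank-free slice bound with common constants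
  obtain ⟨K₀, hK₀⟩ : ∃ K₀ : ℝ, K₀ = max (max K₁ K₂) 0 := ⟨_, rfl⟩
  obtain ⟨C₀, hC₀⟩ : ∃ C₀ : ℝ, C₀ = max C₁ C₂ := ⟨_, rfl⟩
  have hC₀pos : 0 < C₀ := by rw [hC₀]; exact lt_max_of_lt_left hC₁
  have hK₁le : K₁ ≤ K₀ := by rw [hK₀]; exact (le_max_left _ _).trans (le_max_left _ _)
  have hK₂le : K₂ ≤ K₀ := by rw [hK₀]; exact (le_max_right _ _).trans (le_max_left _ _)
  have hK₀nn : 0 ≤ K₀ := by rw [hK₀]; exact le_max_right _ _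
  have slice : ∀ w X Y Z : ℕ, 0 < w → 0 < X → 0 < Y → 0 < Z → Nat.Coprime X Y →
      X ^ 4 + Y ^ 4 = w * Z ^ 4 → (Z : ℝ) ≤ C₀ * (w : ℝ) ^ K₀ := by
    intro w X Y Z hw hX hY hZ hcop heq
    have hw1 : (1 : ℝ) ≤ (w : ℝ) := by exact_mod_cast hw
    have hpow0 : 0 ≤ (w : ℝ) ^ K₀ := Real.rpow_nonneg (by positivity) _
    rcases Classical.em (RankLeOne w) with hr | hr
    · calc (Z : ℝ) ≤ C₁ * (w : ℝ) ^ K₁ := h₁ w X Y Z hw hX hY hZ hcop heq hr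
        _ ≤ C₀ * (w : ℝ) ^ K₀ := by
            apply mul_le_mul _ (Real.rpow_le_rpow_of_exponent_le hw1 hK₁le)
              (Real.rpow_nonneg (by positivity) _) hC₀pos.le
            rw [hC₀]; exact le_max_left _ _
    · calc (Z : ℝ) ≤ C₂ * (w : ℝ) ^ K₂ := h₂ w X Y Z hw hX hY hZ hcop heq hr
        _ ≤ C₀ * (w : ℝ) ^ K₀ := by
            apply mul_le_mul _ (Real.rpow_le_rpow_of_exponent_le hw1 hK₂le)
              (Real.rpow_nonneg (by positivity) _) hC₀pos.le
            rw [hC₀]; exact le_max_right _ _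
  -- constants of QT
  have hCτ : 0 < C₀ ^ τ := Real.rpow_pos_of_pos hC₀pos τ
  refine ⟨τ, max K₃ (τ * K₀), min C₃ (C₀ ^ τ)⁻¹, hτ, lt_min hC₃ (inv_pos.mpr hCτ), ?_⟩
  intro a v w Y Z ha hv hw hY hZ heq hcop
  have hvw1 : (1 : ℝ) ≤ ((v * w : ℕ) : ℝ) := by exact_mod_cast Nat.mul_pos hv hw
  have hZ0 : (0 : ℝ) ≤ (Z : ℝ) := by positivity
  rcases Classical.em (v = 1 ∧ ∃ X : ℕ, a = X ^ 4) with ⟨hv1, X, rfl⟩ | hs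
  · -- the isotypic slice
    subst hv1
    have hX : 0 < X := Nat.pos_of_ne_zero (by rintro rfl; simp at ha)
    have heq' : X ^ 4 + Y ^ 4 = w * Z ^ 4 := by simpa using heq
    have hcop4 : Nat.Coprime (X ^ 4) (Y ^ 4) := by simpa using hcop
    have hcop' : Nat.Coprime X Y :=
      (Nat.coprime_pow_left_iff (by norm_num) _ _).mp
        ((Nat.coprime_pow_right_iff (by norm_num) _ _).mp hcop4)
    have hZle := slice w X Y Z hw hX hY hZ hcop' heq'
    have hw1 : (1 : ℝ) ≤ (w : ℝ) := by exact_mod_cast hw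
    have h1 : (Z : ℝ) ^ τ ≤ (C₀ * (w : ℝ) ^ K₀) ^ τ := Real.rpow_le_rpow hZ0 hZle hτ.le
    have h2 : (C₀ * (w : ℝ) ^ K₀) ^ τ = C₀ ^ τ * (w : ℝ) ^ (K₀ * τ) := by
      rw [Real.mul_rpow hC₀pos.le (Real.rpow_nonneg (Nat.cast_nonneg w) _),
        ← Real.rpow_mul (Nat.cast_nonneg w)]
    have h3 : (w : ℝ) ^ (K₀ * τ) ≤ (w : ℝ) ^ (max K₃ (τ * K₀)) :=
      Real.rpow_le_rpow_of_exponent_le hw1 (by rw [mul_comm]; exact le_max_right _ _)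
    have h4 : (1 : ℝ) ≤ ((X ^ 4 : ℕ) : ℝ) := by exact_mod_cast ha
    have h5 : ((1 * w : ℕ) : ℝ) = (w : ℝ) := by push_cast; ring
    have hwpow0 : 0 ≤ (w : ℝ) ^ (max K₃ (τ * K₀)) := Real.rpow_nonneg (by positivity) _
    calc min C₃ (C₀ ^ τ)⁻¹ * (Z : ℝ) ^ τ ≤ (C₀ ^ τ)⁻¹ * (C₀ ^ τ * (w : ℝ) ^ (K₀ * τ)) :=
          mul_le_mul (min_le_right _ _) (h1.trans_eq h2) (Real.rpow_nonneg hZ0 _)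
            (inv_nonneg.mpr hCτ.le)
      _ = (w : ℝ) ^ (K₀ * τ) := by rw [← mul_assoc, inv_mul_cancel₀ hCτ.ne', one_mul]
      _ ≤ (w : ℝ) ^ (max K₃ (τ * K₀)) := h3
      _ ≤ ((X ^ 4 : ℕ) : ℝ) * (w : ℝ) ^ (max K₃ (τ * K₀)) := le_mul_of_one_le_left hwpow0 h4
      _ = ((X ^ 4 : ℕ) : ℝ) * ((1 * w : ℕ) : ℝ) ^ (max K₃ (τ * K₀)) := by rw [h5]
  · -- off the slice: the residual
    have key := h₃ a v w Y Z ha hv hw hY hZ heq hcop hs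
    calc min C₃ (C₀ ^ τ)⁻¹ * (Z : ℝ) ^ τ ≤ C₃ * (Z : ℝ) ^ τ :=
          mul_le_mul_of_nonneg_right (min_le_left _ _) (Real.rpow_nonneg hZ0 _)
      _ ≤ (a : ℝ) * ((v * w : ℕ) : ℝ) ^ K₃ := key
      _ ≤ (a : ℝ) * ((v * w : ℕ) : ℝ) ^ (max K₃ (τ * K₀)) :=
          mul_le_mul_of_nonneg_left (Real.rpow_le_rpow_of_exponent_le hvw1 (le_max_left _ _))
            (by positivity)

/-! ## Proved glue II: the transfer QT ⟹ crux (the dictionary, certified) -/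

/-- **Log-linear core of the transfer.**  Data: the small summand `a`, the large one `b` (`c ≤ 2b`), `c`, the excess
`E` with `Π⁴ = abcE`, the twist size `M` (`= vw`, `M ≤ E³`, `c ≤ M·Z⁴`) and the QT instance `C·Z^τ ≤ a·M^{K₀}`.
Conclusion: `(2 + θτ/4)·log c ≤ 4·log Π + log 2 − θ·log C` whenever `0 < θ ≤ 1` and `θ(τ + 4K₀) ≤ 4/3`
(multiply the QT-log-inequality by `θ/4`, use `θ·log a ≤ log a`, `θ(τ+4K₀)/4·log M ≤ log M/3 ≤ log E`, and
`2 log c ≤ log c + log 2 + log b`). -/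
theorem core_log {τ K₀ C θ : ℝ} (hτ : 0 < τ) (_hK₀ : 0 ≤ K₀) (hC : 0 < C) (hθ : 0 < θ) (hθ1 : θ ≤ 1)
    (hθL : θ * (τ + 4 * K₀) ≤ 4 / 3)
    {a b c E M Z P : ℕ} (ha : 0 < a) (hb : 0 < b) (hc : 0 < c) (hE : 0 < E) (hM : 0 < M)
    (hZ : 0 < Z) (hP : 0 < P)
    (hP4 : P ^ 4 = a * b * c * E) (hcb : c ≤ 2 * b) (hEM : M ≤ E ^ 3) (hcM : c ≤ M * Z ^ 4)
    (hQ : C * (Z : ℝ) ^ τ ≤ (a : ℝ) * (M : ℝ) ^ K₀) :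
    (2 + θ * τ / 4) * Real.log c ≤ 4 * Real.log P + Real.log 2 - θ * Real.log C := by
  have ha' : (0 : ℝ) < a := by exact_mod_cast ha
  have hb' : (0 : ℝ) < b := by exact_mod_cast hb
  have hc' : (0 : ℝ) < c := by exact_mod_cast hc
  have hE' : (0 : ℝ) < E := by exact_mod_cast hE
  have hM' : (0 : ℝ) < M := by exact_mod_cast hM
  have hZ' : (0 : ℝ) < Z := by exact_mod_cast hZ
  have hP' : (0 : ℝ) < P := by exact_mod_cast hP
  have la0 : 0 ≤ Real.log a := Real.log_nonneg (by exact_mod_cast ha)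
  have lM0 : 0 ≤ Real.log M := Real.log_nonneg (by exact_mod_cast hM)
  have lE0 : 0 ≤ Real.log E := Real.log_nonneg (by exact_mod_cast hE)
  -- F1: 4 log P = log a + log b + log c + log E
  have F1 : 4 * Real.log P = Real.log a + Real.log b + Real.log c + Real.log E := by
    have h : ((P : ℝ)) ^ 4 = (a : ℝ) * b * c * E := by exact_mod_cast hP4
    have e0 := congrArg Real.log h
    have e1 : Real.log ((a : ℝ) * b * c * E) = Real.log ((a : ℝ) * b * c) + Real.log E :=
      Real.log_mul (by positivity) hE'.ne'
    have e2 : Real.log ((a : ℝ) * b * c) = Real.log ((a : ℝ) * b) + Real.log c :=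
      Real.log_mul (by positivity) hc'.ne'
    have e3 : Real.log ((a : ℝ) * b) = Real.log a + Real.log b := Real.log_mul ha'.ne' hb'.ne'
    have e4 : Real.log ((P : ℝ) ^ 4) = (4 : ℕ) * Real.log P := Real.log_pow _ 4
    rw [e4, e1, e2, e3] at e0
    push_cast at e0
    linarith
  -- F2: log c ≤ log 2 + log b
  have F2 : Real.log c ≤ Real.log 2 + Real.log b := by
    have h : (c : ℝ) ≤ 2 * b := by exact_mod_cast hcb
    have := Real.log_le_log hc' h
    rwa [Real.log_mul (by norm_num) hb'.ne'] at this
  -- F3: log M ≤ 3 log E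
  have F3 : Real.log M ≤ 3 * Real.log E := by
    have h : (M : ℝ) ≤ (E : ℝ) ^ 3 := by exact_mod_cast hEM
    have h' := Real.log_le_log hM' h
    have e : Real.log ((E : ℝ) ^ 3) = (3 : ℕ) * Real.log E := Real.log_pow _ 3
    rw [e] at h'
    push_cast at h'
    linarith
  -- F4: log C + τ log Z ≤ log a + K₀ log M
  have F4 : Real.log C + τ * Real.log Z ≤ Real.log a + K₀ * Real.log M := by
    have hl : 0 < C * (Z : ℝ) ^ τ := by positivity
    have h' := Real.log_le_log hl hQ
    rw [Real.log_mul hC.ne' (Real.rpow_pos_of_pos hZ' τ).ne', Real.log_rpow hZ',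
      Real.log_mul ha'.ne' (Real.rpow_pos_of_pos hM' K₀).ne', Real.log_rpow hM'] at h'
    linarith
  -- F5: log c ≤ log M + 4 log Z
  have F5 : Real.log c ≤ Real.log M + 4 * Real.log Z := by
    have h : (c : ℝ) ≤ M * (Z : ℝ) ^ 4 := by exact_mod_cast hcM
    have h' := Real.log_le_log hc' h
    have e : Real.log ((Z : ℝ) ^ 4) = (4 : ℕ) * Real.log Z := Real.log_pow _ 4
    rw [Real.log_mul hM'.ne' (by positivity), e] at h'
    push_cast at h'
    linarith
  -- G2: τ log c ≤ 4 log a + (τ + 4K₀) log M − 4 log C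
  have G1 : τ * Real.log c ≤ τ * (Real.log M + 4 * Real.log Z) := mul_le_mul_of_nonneg_left F5 hτ.le
  have G2 : τ * Real.log c ≤ 4 * Real.log a + (τ + 4 * K₀) * Real.log M - 4 * Real.log C := by
    nlinarith [G1, F4]
  -- H1: scale by θ/4
  have H1 : θ * τ / 4 * Real.log c ≤
      θ * Real.log a + θ * (τ + 4 * K₀) / 4 * Real.log M - θ * Real.log C := by
    have h := mul_le_mul_of_nonneg_left G2 (by positivity : (0 : ℝ) ≤ θ / 4)
    nlinarith [h]
  -- H2: θ log a ≤ log a ;  H3: θ(τ+4K₀)/4 · log M ≤ log M / 3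
  have H2 : θ * Real.log a ≤ Real.log a := by nlinarith [mul_nonneg (sub_nonneg.mpr hθ1) la0]
  have H3 : θ * (τ + 4 * K₀) / 4 * Real.log M ≤ 1 / 3 * Real.log M := by
    nlinarith [mul_nonneg (sub_nonneg.mpr hθL) lM0]
  nlinarith [F1, F2, F3, H1, H2, H3, lE0]

/-- Explicit form of a level-4 tower monomial: `∏ᵢ tᵢ^(i+1) = t₀·t₁²·t₂³·t₃⁴`. -/
theorem prod_tower_four (t : Fin 4 → ℕ) :
    (∏ i, t i ^ (i.val + 1)) = t 0 * t 1 ^ 2 * t 2 ^ 3 * t 3 ^ 4 := by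
  simp only [Fin.prod_univ_four, Fin.isValue, Fin.val_zero, Fin.val_one, Fin.val_two]
  simp only [show (3 : Fin 4).val = 3 from rfl]
  ring

/-- **The transfer, PROVED: QT ⟹ `TowerFourSubLiouville`.**  With `K₀ = max K 0`, `L = (τ + 4K₀)/4`,
`θ = 1/(1 + 3L)`, `κ = θτ/4 > 0`, `A = 4/(2 + κ) < 2`: for a positive coprime tower point write `a = u·X⁴`,
`b = v·Y⁴`, `c = w·Z⁴`; if `a ≤ b` apply QT to `(a, v, w, Y, Z)`, else to `(b, u, w, X, Z)`; `core_log` with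
`Π⁴ = abcE` (`towerProd_pow_four_eq`), `E³ ≥ vw` (resp. `uw`), `c ≤ 2·max(a,b)`, `c ≤ (vw)Z⁴` gives
`(2 + κ) log c ≤ 4 log Π + log 2 − θ log C`, i.e. `c ≤ e^{c₀}·Π^A < e^{c₀+1}·Π^{A+ε}`. -/
theorem towerFour_of_quarticThue (h : QuarticThueBound) : TowerFourSubLiouville := by
  obtain ⟨τ, K, C, hτ, hC, hQ⟩ := h
  -- K ≥ 0 without loss
  obtain ⟨K₀, hK₀def⟩ : ∃ K₀ : ℝ, K₀ = max K 0 := ⟨_, rfl⟩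
  have hK₀ : 0 ≤ K₀ := by rw [hK₀def]; exact le_max_right _ _
  have hQ₀ : ∀ a v w Y Z : ℕ, 0 < a → 0 < v → 0 < w → 0 < Y → 0 < Z →
      a + v * Y ^ 4 = w * Z ^ 4 → Nat.Coprime a (v * Y ^ 4) →
      C * (Z : ℝ) ^ τ ≤ (a : ℝ) * ((v * w : ℕ) : ℝ) ^ K₀ := by
    intro a v w Y Z ha hv hw hY hZ heq hcop
    have hvw : (1 : ℝ) ≤ ((v * w : ℕ) : ℝ) := by exact_mod_cast Nat.mul_pos hv hw
    exact (hQ a v w Y Z ha hv hw hY hZ heq hcop).trans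
      (mul_le_mul_of_nonneg_left
        (Real.rpow_le_rpow_of_exponent_le hvw (by rw [hK₀def]; exact le_max_left _ _)) (by positivity))
  -- the exponents
  obtain ⟨θ, hθdef⟩ : ∃ θ : ℝ, θ = 1 / (1 + 3 * ((τ + 4 * K₀) / 4)) := ⟨_, rfl⟩
  have hLpos : 0 < (τ + 4 * K₀) / 4 := by positivity
  have hθ : 0 < θ := by rw [hθdef]; positivity
  have hθ1 : θ ≤ 1 := by
    rw [hθdef, div_le_one (by positivity)]; linarith
  have hθL : θ * (τ + 4 * K₀) ≤ 4 / 3 := by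
    rw [hθdef, one_div, inv_mul_le_iff₀ (by positivity)]
    linarith
  obtain ⟨κ, hκdef⟩ : ∃ κ : ℝ, κ = θ * τ / 4 := ⟨_, rfl⟩
  have hκ : 0 < κ := by rw [hκdef]; positivity
  obtain ⟨A, hAdef⟩ : ∃ A : ℝ, A = 4 / (2 + κ) := ⟨_, rfl⟩
  have hA2 : A < 2 := by rw [hAdef, div_lt_iff₀ (by positivity)]; linarith
  obtain ⟨c₀, hc₀def⟩ : ∃ c₀ : ℝ, c₀ = (Real.log 2 - θ * Real.log C) / (2 + κ) := ⟨_, rfl⟩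
  refine ⟨A, hA2, fun ε hε => ⟨Real.exp (c₀ + 1), Real.exp_pos _, ?_⟩⟩
  intro x y z hpos hsum hcop
  -- coordinates
  have hx0 : 0 < x 0 := (hpos 0).1
  have hx1 : 0 < x 1 := (hpos 1).1
  have hx2 : 0 < x 2 := (hpos 2).1
  have hx3 : 0 < x 3 := (hpos 3).1
  have hy0 : 0 < y 0 := (hpos 0).2.1
  have hy1 : 0 < y 1 := (hpos 1).2.1
  have hy2 : 0 < y 2 := (hpos 2).2.1
  have hy3 : 0 < y 3 := (hpos 3).2.1
  have hz0 : 0 < z 0 := (hpos 0).2.2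
  have hz1 : 0 < z 1 := (hpos 1).2.2
  have hz2 : 0 < z 2 := (hpos 2).2.2
  have hz3 : 0 < z 3 := (hpos 3).2.2
  have hP4 := towerProd_pow_four_eq x y z
  rw [prod_tower_four x, prod_tower_four y, prod_tower_four z] at hP4 hsum
  rw [prod_tower_four x, prod_tower_four y] at hcop
  rw [prod_tower_four z]
  have hPprod : (∏ i, x i * y i * z i) = (x 0 * y 0 * z 0) * (x 1 * y 1 * z 1) * (x 2 * y 2 * z 2) *
      (x 3 * y 3 * z 3) := Fin.prod_univ_four _
  rw [hPprod] at hP4 ⊢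
  -- abbreviations (plain naturals)
  generalize hu : x 0 * x 1 ^ 2 * x 2 ^ 3 = u at hsum hcop hP4
  generalize hv : y 0 * y 1 ^ 2 * y 2 ^ 3 = v at hsum hcop hP4
  generalize hw : z 0 * z 1 ^ 2 * z 2 ^ 3 = w at hsum hcop hP4 ⊢
  generalize hE : (x 0 * y 0 * z 0) ^ 3 * (x 1 * y 1 * z 1) ^ 2 * (x 2 * y 2 * z 2) = E at hP4
  generalize hP : x 0 * y 0 * z 0 * (x 1 * y 1 * z 1) * (x 2 * y 2 * z 2) * (x 3 * y 3 * z 3) = P at hP4 ⊢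
  have hu0 : 0 < u := by rw [← hu]; positivity
  have hv0 : 0 < v := by rw [← hv]; positivity
  have hw0 : 0 < w := by rw [← hw]; positivity
  have hE0 : 0 < E := by rw [← hE]; positivity
  have hP0 : 0 < P := by rw [← hP]; positivity
  -- the excess dominates the twist: v·w ≤ E³ and u·w ≤ E³
  have hEvw : v * w ≤ E ^ 3 := by
    have hR : 1 ≤ x 0 ^ 9 * x 1 ^ 6 * x 2 ^ 3 * (y 0 ^ 8 * y 1 ^ 4) * (z 0 ^ 8 * z 1 ^ 4) :=
      Nat.succ_le_of_lt (by positivity)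
    calc v * w = v * w * 1 := (mul_one _).symm
      _ ≤ v * w * (x 0 ^ 9 * x 1 ^ 6 * x 2 ^ 3 * (y 0 ^ 8 * y 1 ^ 4) * (z 0 ^ 8 * z 1 ^ 4)) :=
          Nat.mul_le_mul_left _ hR
      _ = E ^ 3 := by rw [← hv, ← hw, ← hE]; ring
  have hEuw : u * w ≤ E ^ 3 := by
    have hR : 1 ≤ y 0 ^ 9 * y 1 ^ 6 * y 2 ^ 3 * (x 0 ^ 8 * x 1 ^ 4) * (z 0 ^ 8 * z 1 ^ 4) :=
      Nat.succ_le_of_lt (by positivity)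
    calc u * w = u * w * 1 := (mul_one _).symm
      _ ≤ u * w * (y 0 ^ 9 * y 1 ^ 6 * y 2 ^ 3 * (x 0 ^ 8 * x 1 ^ 4) * (z 0 ^ 8 * z 1 ^ 4)) :=
          Nat.mul_le_mul_left _ hR
      _ = E ^ 3 := by rw [← hu, ← hw, ← hE]; ring
  -- c ≤ (vw)Z⁴ and c ≤ (uw)Z⁴
  have hcvw : w * z 3 ^ 4 ≤ v * w * z 3 ^ 4 := by
    rw [mul_assoc]; exact Nat.le_mul_of_pos_left _ hv0
  have hcuw : w * z 3 ^ 4 ≤ u * w * z 3 ^ 4 := by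
    rw [mul_assoc]; exact Nat.le_mul_of_pos_left _ hu0
  have hc0 : 0 < w * z 3 ^ 4 := by positivity
  -- the log-core in either orientation
  have hcore : (2 + θ * τ / 4) * Real.log ((w * z 3 ^ 4 : ℕ) : ℝ) ≤
      4 * Real.log (P : ℝ) + Real.log 2 - θ * Real.log C := by
    rcases le_total (u * x 3 ^ 4) (v * y 3 ^ 4) with hab | hba
    · -- a ≤ b : QT at (a, v, w, Y, Z)
      have hQi := hQ₀ (u * x 3 ^ 4) v w (y 3) (z 3) (by positivity) hv0 hw0 hy3 hz3 hsum hcop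
      have hcb : w * z 3 ^ 4 ≤ 2 * (v * y 3 ^ 4) := by omega
      have hP4' : P ^ 4 = (u * x 3 ^ 4) * (v * y 3 ^ 4) * (w * z 3 ^ 4) * E := hP4
      have := core_log hτ hK₀ hC hθ hθ1 hθL (by positivity) (by positivity) hc0 hE0 (Nat.mul_pos hv0 hw0)
        hz3 hP0 hP4' hcb hEvw hcvw hQi
      exact this
    · -- b ≤ a : QT at (b, u, w, X, Z)
      have hsum' : v * y 3 ^ 4 + u * x 3 ^ 4 = w * z 3 ^ 4 := by rw [← hsum]; ring
      have hQi := hQ₀ (v * y 3 ^ 4) u w (x 3) (z 3) (by positivity) hu0 hw0 hx3 hz3 hsum' hcop.symm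
      have hcb : w * z 3 ^ 4 ≤ 2 * (u * x 3 ^ 4) := by omega
      have hP4' : P ^ 4 = (v * y 3 ^ 4) * (u * x 3 ^ 4) * (w * z 3 ^ 4) * E := by rw [hP4]; ring
      have := core_log hτ hK₀ hC hθ hθ1 hθL (by positivity) (by positivity) hc0 hE0 (Nat.mul_pos hu0 hw0)
        hz3 hP0 hP4' hcb hEuw hcuw hQi
      exact this
  -- finish: exponentiate
  have hc' : (0 : ℝ) < ((w * z 3 ^ 4 : ℕ) : ℝ) := by exact_mod_cast hc0
  have hP' : (0 : ℝ) < (P : ℝ) := by exact_mod_cast hP0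
  have lP0 : 0 ≤ Real.log (P : ℝ) := Real.log_nonneg (by exact_mod_cast hP0)
  have h2κ : 0 < 2 + κ := by positivity
  have hlc : Real.log ((w * z 3 ^ 4 : ℕ) : ℝ) ≤ A * Real.log (P : ℝ) + c₀ := by
    rw [hAdef, hc₀def, div_mul_eq_mul_div, ← add_div, le_div_iff₀ h2κ]
    rw [hκdef]
    nlinarith [hcore]
  have hlc' : Real.log ((w * z 3 ^ 4 : ℕ) : ℝ) ≤ (A + ε) * Real.log (P : ℝ) + c₀ := by
    nlinarith [hlc, mul_nonneg hε.le lP0]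
  calc ((w * z 3 ^ 4 : ℕ) : ℝ) = Real.exp (Real.log ((w * z 3 ^ 4 : ℕ) : ℝ)) := (Real.exp_log hc').symm
    _ ≤ Real.exp ((A + ε) * Real.log (P : ℝ) + c₀) := Real.exp_le_exp.mpr hlc'
    _ = Real.exp c₀ * (P : ℝ) ^ (A + ε) := by
        rw [Real.exp_add, Real.rpow_def_of_pos hP', mul_comm (Real.log (P : ℝ)) (A + ε)]
        ring
    _ < Real.exp (c₀ + 1) * (P : ℝ) ^ (A + ε) := by
        apply mul_lt_mul_of_pos_right _ (Real.rpow_pos_of_pos hP' _)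
        exact Real.exp_lt_exp.mpr (by linarith)

/-- **Converse, PROVED: crux ⟹ QT** — so `QuarticThueBound` is crux-EQUIVALENT (the crux in Thue coordinates).
Given `A < 2` put `s = (max A 1 + 2)/2 ∈ [3/2, 2)`, `ε = s − A > 0`; the tower point `x = (a,1,1,1)`, `y = (v,1,1,Y)`,
`z = (w,1,1,Z)` has `Π = a·v·w·Y·Z`, `c = w·Z⁴`, and `Y⁴ ≤ vY⁴ < wZ⁴` gives `4 log Y ≤ log w + 4 log Z`; hence
`(4 − 2s)·log Z < log C + s·log a + (5s/4)(log v + log w)`, i.e. QT with `τ = (4 − 2s)/s`, `K = 5/4`,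
constant `C^{−1/s}`. -/
theorem quarticThueBound_of_towerFour (h : TowerFourSubLiouville) : QuarticThueBound := by
  obtain ⟨A, hA2, hT⟩ := h
  obtain ⟨s, hsdef⟩ : ∃ s : ℝ, s = (max A 1 + 2) / 2 := ⟨_, rfl⟩
  have hmax1 : 1 ≤ max A 1 := le_max_right _ _
  have hmaxA : A ≤ max A 1 := le_max_left _ _
  have hmax2 : max A 1 < 2 := max_lt hA2 (by norm_num)
  have hs1 : 1 < s := by rw [hsdef]; linarith
  have hs2 : s < 2 := by rw [hsdef]; linarith
  have hs0 : 0 < s := by linarith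
  have hεpos : 0 < s - A := by rw [hsdef]; linarith
  obtain ⟨C, hC, hT⟩ := hT (s - A) hεpos
  refine ⟨(4 - 2 * s) / s, 5 / 4, Real.exp (-(Real.log C / s)), div_pos (by linarith) hs0, Real.exp_pos _, ?_⟩
  intro a v w Y Z ha hv hw hY hZ heq hcop
  -- the tower point (a,1,1,1), (v,1,1,Y), (w,1,1,Z)
  have ha1 : (∏ i, (![a, 1, 1, 1] : Fin 4 → ℕ) i ^ (i.val + 1)) = a := by
    rw [prod_tower_four]; simp
  have hb1 : (∏ i, (![v, 1, 1, Y] : Fin 4 → ℕ) i ^ (i.val + 1)) = v * Y ^ 4 := by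
    rw [prod_tower_four]; simp
  have hc1 : (∏ i, (![w, 1, 1, Z] : Fin 4 → ℕ) i ^ (i.val + 1)) = w * Z ^ 4 := by
    rw [prod_tower_four]; simp
  have hP1 : (∏ i, (![a, 1, 1, 1] : Fin 4 → ℕ) i * (![v, 1, 1, Y] : Fin 4 → ℕ) i * (![w, 1, 1, Z] : Fin 4 → ℕ) i)
      = a * v * w * (Y * Z) := by
    rw [Fin.prod_univ_four]; simp
  have key := hT ![a, 1, 1, 1] ![v, 1, 1, Y] ![w, 1, 1, Z]
    (by intro i; fin_cases i <;> simp [ha, hv, hw, hY, hZ]) (by rw [ha1, hb1, hc1]; exact heq)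
    (by rw [ha1, hb1]; exact hcop)
  rw [hc1, hP1, show A + (s - A) = s by ring] at key
  -- logs
  have ha' : (0 : ℝ) < a := by exact_mod_cast ha
  have hv' : (0 : ℝ) < v := by exact_mod_cast hv
  have hw' : (0 : ℝ) < w := by exact_mod_cast hw
  have hY' : (0 : ℝ) < Y := by exact_mod_cast hY
  have hZ' : (0 : ℝ) < Z := by exact_mod_cast hZ
  have lv0 : 0 ≤ Real.log v := Real.log_nonneg (by exact_mod_cast hv)
  have lw0 : 0 ≤ Real.log w := Real.log_nonneg (by exact_mod_cast hw)
  -- L1: log w + 4 log Z < log C + s (log a + log v + log w + log Y + log Z)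
  have L1 : Real.log w + 4 * Real.log Z <
      Real.log C + s * (Real.log a + Real.log v + Real.log w + Real.log Y + Real.log Z) := by
    have hlhs : (0 : ℝ) < ((w * Z ^ 4 : ℕ) : ℝ) := by positivity
    have h1 := Real.log_lt_log hlhs key
    have e1 : Real.log ((w * Z ^ 4 : ℕ) : ℝ) = Real.log w + 4 * Real.log Z := by
      have e : Real.log ((Z : ℝ) ^ 4) = (4 : ℕ) * Real.log Z := Real.log_pow _ 4
      push_cast
      rw [Real.log_mul hw'.ne' (by positivity), e]
      push_cast
      ring
    have hPi : (0 : ℝ) < ((a * v * w * (Y * Z) : ℕ) : ℝ) := by positivity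
    have e2 : Real.log (C * ((a * v * w * (Y * Z) : ℕ) : ℝ) ^ s) =
        Real.log C + s * (Real.log a + Real.log v + Real.log w + Real.log Y + Real.log Z) := by
      rw [Real.log_mul hC.ne' (Real.rpow_pos_of_pos hPi s).ne', Real.log_rpow hPi]
      have e3 : Real.log ((a * v * w * (Y * Z) : ℕ) : ℝ) =
          Real.log a + Real.log v + Real.log w + Real.log Y + Real.log Z := by
        push_cast
        rw [Real.log_mul (by positivity) (by positivity), Real.log_mul (by positivity) hw'.ne',
          Real.log_mul ha'.ne' hv'.ne', Real.log_mul hY'.ne' hZ'.ne']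
        ring
      rw [e3]
    linarith [h1, e1, e2]
  -- L2: 4 log Y ≤ log w + 4 log Z  (Y⁴ ≤ vY⁴ ≤ a + vY⁴ = wZ⁴)
  have L2 : 4 * Real.log Y ≤ Real.log w + 4 * Real.log Z := by
    have hnat : Y ^ 4 ≤ w * Z ^ 4 := by
      calc Y ^ 4 = 1 * Y ^ 4 := (one_mul _).symm
        _ ≤ v * Y ^ 4 := Nat.mul_le_mul_right _ hv
        _ ≤ a + v * Y ^ 4 := Nat.le_add_left _ _
        _ = w * Z ^ 4 := heq
    have hR : ((Y : ℝ)) ^ 4 ≤ (w : ℝ) * (Z : ℝ) ^ 4 := by exact_mod_cast hnat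
    have h1 := Real.log_le_log (by positivity) hR
    have eY : Real.log ((Y : ℝ) ^ 4) = (4 : ℕ) * Real.log Y := Real.log_pow _ 4
    have eZ : Real.log ((Z : ℝ) ^ 4) = (4 : ℕ) * Real.log Z := Real.log_pow _ 4
    rw [eY, Real.log_mul hw'.ne' (by positivity), eZ] at h1
    push_cast at h1
    linarith
  -- L3: (4 − 2s) log Z < log C + s log a + (5s/4)(log v + log w)
  have L3 : (4 - 2 * s) * Real.log Z <
      Real.log C + s * Real.log a + 5 / 4 * s * (Real.log v + Real.log w) := by
    have h2 : s * (4 * Real.log Y) ≤ s * (Real.log w + 4 * Real.log Z) :=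
      mul_le_mul_of_nonneg_left L2 hs0.le
    nlinarith [L1, h2, mul_nonneg hs0.le lv0, mul_nonneg hs0.le lw0, lw0]
  -- L4: divide by s
  have L4 : -(Real.log C / s) + (4 - 2 * s) / s * Real.log Z ≤
      Real.log a + 5 / 4 * (Real.log v + Real.log w) := by
    rw [← neg_div, div_mul_eq_mul_div, ← add_div, div_le_iff₀ hs0]
    nlinarith [L3]
  -- exponentiate
  have hM' : (0 : ℝ) < ((v * w : ℕ) : ℝ) := by positivity
  have eM : Real.log ((v * w : ℕ) : ℝ) = Real.log v + Real.log w := by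
    push_cast
    exact Real.log_mul hv'.ne' hw'.ne'
  calc Real.exp (-(Real.log C / s)) * (Z : ℝ) ^ ((4 - 2 * s) / s)
      = Real.exp (-(Real.log C / s) + (4 - 2 * s) / s * Real.log Z) := by
        rw [Real.exp_add, Real.rpow_def_of_pos hZ', mul_comm (Real.log (Z : ℝ))]
    _ ≤ Real.exp (Real.log a + 5 / 4 * (Real.log v + Real.log w)) := Real.exp_le_exp.mpr L4
    _ = (a : ℝ) * ((v * w : ℕ) : ℝ) ^ ((5 : ℝ) / 4) := by
        rw [Real.exp_add, Real.exp_log ha', Real.rpow_def_of_pos hM', eM,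
          mul_comm (Real.log v + Real.log w) ((5 : ℝ) / 4)]

/-- Hence QT (and the residual stub R, its restriction) is abc-sandwiched: `ABC ⟹ crux ⟹ QT`, with the disprover's
landed `towerFourSubLiouville_of_abc`. No refutation of R or QT short of `¬ABC`. -/
theorem quarticThueBound_of_abc (habc : _root_.ABC) : QuarticThueBound :=
  quarticThueBound_of_towerFour
    (Summit.ABC.ABC.Theorems.TowerFourSubLiouville.Negative.towerFourSubLiouville_of_abc habc)

/-- The normal form is exact: `QuarticThueBound ↔ TowerFourSubLiouville` (both directions proved here). -/
theorem quarticThueBound_iff_towerFour : QuarticThueBound ↔ TowerFourSubLiouville :=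
  ⟨towerFour_of_quarticThue, quarticThueBound_of_towerFour⟩

/-! ## The composition (kernel-checked; concludes the crux BY NAME) -/

/-- **`TowerFourSubLiouville_of`** — the glue of the line: the height toolkit (D) feeds Dem'janenko–Manin on the
rank-≤1 isotypic slice (M1); with the rank-≥2 slice (M2) and the off-slice residual (R) this is QT everywhere
(`quarticThueBound_of_slices`), and the PROVED transfer `towerFour_of_quarticThue` concludes the crux. -/
theorem TowerFourSubLiouville_of (hD : Registered.stub_uniformHeightDifference)
    (hM1 : Registered.stub_isotypicRankLeOne) (hM2 : Registered.stub_isotypicHighRank)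
    (hR : Registered.stub_quarticThueOffSlice) :
    Summit.ABC.ABC.Theses.IneffectiveSubspace.TowerFourSubLiouville :=
  towerFour_of_quarticThue (quarticThueBound_of_slices (hM1 hD) hM2 hR)

/-- Wiring check: the registered stubs feed `TowerFourSubLiouville_of` as stated (definitional unfolding only). -/
example : Summit.ABC.ABC.Theses.IneffectiveSubspace.TowerFourSubLiouville :=
  TowerFourSubLiouville_of stub_uniformHeightDifference stub_isotypicRankLeOne stub_isotypicHighRank
    stub_quarticThueOffSlice

/-! ## Side facts (proved): the two Dem'janenko–Manin points lie on `E_w`, and the tree's height toolkit is available -/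

/-- The two Manin points `P₁ = (wZ²/Y², wX²Z/Y³)`, `P₂ = (wZ²/X², wY²Z/X³)` of a solution of `X⁴ + Y⁴ = w·Z⁴` satisfy
the equation `y² = x³ − w·x` of `E_w`, here cleared of the denominators `Y⁶` (resp. `X⁶`): pure algebra — the content
of M1 is that the two naive heights are EQUAL (`= log(wZ²)` for positive coprime data). -/
theorem maninPoints_on_curve (w X Y Z : ℚ) (h : X ^ 4 + Y ^ 4 = w * Z ^ 4) :
    (w * X ^ 2 * Z) ^ 2 = (w * Z ^ 2) ^ 3 - w * (w * Z ^ 2) * Y ^ 4 ∧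
    (w * Y ^ 2 * Z) ^ 2 = (w * Z ^ 2) ^ 3 - w * (w * Z ^ 2) * X ^ 4 := by
  constructor
  · linear_combination (w ^ 2 * Z ^ 2) * h
  · linear_combination (w ^ 2 * Z ^ 2) * h

/-- The chord identity behind near-orthogonality: with `x₁ = wZ²/Y²`, `x₂ = wZ²/X²`, slope numerator `X⁵ − Y⁵`,
the `x`-coordinate `λ² − x₁ − x₂` of `P₁ + P₂` is `((X² + XY + Y²)/(Z(X + Y)))²` (polynomial form, over `ℚ`). -/
theorem chord_identity (X Y : ℚ) :
    (X ^ 4 + X ^ 3 * Y + X ^ 2 * Y ^ 2 + X * Y ^ 3 + Y ^ 4) ^ 2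
      - (X ^ 4 + Y ^ 4) * (X ^ 2 + Y ^ 2) * (X + Y) ^ 2
      = X ^ 2 * Y ^ 2 * (X ^ 2 + X * Y + Y ^ 2) ^ 2 := by
  ring

/-- The tree's Néron–Tate toolkit IS available unconditionally over `ℚ` for `E_w` (what M1's proof consumes besides
stub D): parallelogram law and `ĥ(n•P) = n²ĥ(P)`, from `HeightsProofs` (`_holds` discharges), transported to `ℚ`'s
decidable equality by `convert`. -/
theorem toolkit_available (w : ℕ) [(Ew w).IsElliptic] (n : ℤ) (P Q : (Ew w).toAffine.Point) :
    canonicalHeight (P + Q) + canonicalHeight (P - Q) = 2 * canonicalHeight P + 2 * canonicalHeight Q ∧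
    canonicalHeight (n • P) = (n : ℝ) ^ 2 * canonicalHeight P := by
  constructor
  · convert WeierstrassCurve.Affine.Point.parallelogram_law_holds (W := Ew w) P Q
  · convert WeierstrassCurve.Affine.Point.canonicalHeight_zsmul_holds (W := Ew w) n P

end Summit.ABC.ABC.Cruxes.TowerFourSubLiouville.IsotypicDemjanenkoManin

end
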